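import Mathlib
import Literature.AlgebraicGeometry.Resolution.CobordantGame
import Literature.AlgebraicGeometry.Resolution.CobordantChartCoefficients
import Literature.AlgebraicGeometry.Resolution.CobordantChartPlaneSlice
import Literature.AlgebraicGeometry.Resolution.CobordantTupleGame
import Literature.AlgebraicGeometry.Resolution.FormalCoordinateChange
import Summits.ResolutionOfSingularities.ResolutionOfSingularities.Theorems.WeightedInvariantGlobalizeLocalDropCanonize
import Summits.ResolutionOfSingularities.ResolutionOfSingularities.Theorems.WeightedInvariantGlobalizeLocalDropCylinder
import Summits.ResolutionOfSingularities.ResolutionOfSingularities.Theorems.WeightedInvariantGlobalizeLocalDropRegularGerms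
import Summits.ResolutionOfSingularities.ResolutionOfSingularities.Theorems.WeightedInvariantLocalWeightedDropHornedRankEquiv
import Summits.ResolutionOfSingularities.ResolutionOfSingularities.Theorems.WeightedInvariantLocalWeightedDropTangentConeCut
import Summits.ResolutionOfSingularities.ResolutionOfSingularities.Theorems.WeightedInvariantLocalWeightedDropMultiplicityLift

/-!
# `WeightedInvariant.LocalWeightedDrop`, line `hasse-ridge-face-selection`: the POINT BLOW-UP of a MONIC form

Crux item stmt-ResolutionOfSingularities-8899 `LocalWeightedDrop` (route `ResolutionOfSingularities/WeightedInvariant`),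
serving the door `WeightedConstruction` stmt-ResolutionOfSingularities-0571.  [OURS · L1 W4.3, chain w43, stub worker 3: the
first move-brick of N3 (the wild lift) of CRUX-PLAN w43 §3C for the pieces S2 `stub_charTwoDoublePointSurfaceWon` /
S3 `stub_wildUnaryConeSurfaceWon`, on the position space of `WeierstrassForm.exists_monicForm`.  Not a statement of any
manuscript.]

`won_monic_of_pointBlowup` (every characteristic `p`, every dimension `m + 1`, every degree `d ≥ 1`): a MONIC form
`P = y^d + Σ_{j<d} A_j(x') y^j` with `ord A_j > d - j` is won as soon as, for every exceptional point `c' ≠ 0` of the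
point blow-up inside `γ = 0`, every live slot `i₀` and the factorisations `A_j ∘ chart(c') = s^{d-j+1} B_j`, the monic form
ONE DIMENSION DOWN IN HISTORY BUT IN THE SAME NUMBER OF VARIABLES
```
  S = y^d + Σ_{j<d} (s · B_j)|_{x'_{i₀}-slice} · y^j  ∈ k[[s, x'' , y]]
```
is won whenever it is singular.  Ingredients: the move is the classical point blow-up (`TangentConeCut.isMove_X_one`);
the transform is `s^d · g₀`, `g₀ = (γ + Y)^d + s · Σ_j B_j♮ (γ + Y)^j` (`MonicPointBlowup.transform_monic`, via
`MultiplicityLift.cruxChart_last` / `subst_cruxChart_rename`), `s ∤ g₀` (`coeff_top_g₀`), so `g₀` IS the saturated successor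
(`X_pow_mul_eq_X_pow_mul`); a singular successor has `γ^d = g₀(0) = 0` (`constantCoeff_g₀`) hence lies over `γ = 0` and has a
live old slot, tame of weight `1`; there `tameSlice` writes `g₀ = u · Φ(cyl S)` with `S` the slice (`slice_g₀`, via
`MultiplicityLift.slice_*`), and `won_cyl` / `won_subst_iff` / `won_unit_mul_iff` climb back.

What this does NOT do: choose weights, re-prepare (`y ↦ y + φ(x')`) or supply the rank — the slice `S` is monic but its
polyhedron may leave `{|u| > 1}` (order drop, hyperbolic or non-unary cone are then decided by the caller with the landed
`TangentConeCut` / `UnaryConeForm` / `WeierstrassForm` tools).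
-/

set_option linter.dupNamespace false -- mandated namespace of this single-conjunct summit

namespace Summit.ResolutionOfSingularities.ResolutionOfSingularities.Theorems

open Literature.AlgebraicGeometry.Resolution
open Literature.AlgebraicGeometry.Resolution.CobordantGame

namespace MonicPointBlowup

open MvPowerSeries

variable {k : Type} [Field k] {m : ℕ}

/-- The weight vector `(1, …, 1)` on `k[[x', y]]` is `(1, …, 1)` on `x'` with `1` inserted at the `y`-slot. -/
theorem one_eq_insertNth :
    (fun _ : Fin (m + 1) => (1 : ℕ)) = Fin.insertNth (α := fun _ => ℕ) (Fin.last m) 1 (fun _ : Fin m => 1) := by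
  funext i
  rcases Fin.eq_self_or_eq_succAbove (Fin.last m) i with rfl | ⟨j, rfl⟩
  · rw [Fin.insertNth_apply_same]
  · rw [Fin.insertNth_apply_succAbove]

/-- With all weights `1` the crux's chart is the literal chart `CobordantChart.chart`. -/
theorem cruxChart_one_eq_chart {N : ℕ} (c : Fin N → k) :
    cruxChart k (fun _ : Fin N => 1) c = CobordantChart.chart (fun _ : Fin N => 1) c := by
  have h := CobordantChart.cruxChart_eq_chart (k := k) (fun _ : Fin N => 1) c
  simp only [Nat.one_pos, if_true] at h
  exact h

/-- DIVISIBILITY BY `s^n` OF THE POINT-BLOW-UP TRANSFORM of a series of order `≥ n`. -/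
theorem exists_eq_X_pow_mul_of_le_order {N : ℕ} (c : Fin N → k) (H : MvPowerSeries (Fin N) k) (n : ℕ)
    (hn : (n : ℕ∞) ≤ H.order) :
    ∃ B : MvPowerSeries (Fin (N + 1)) k, subst (CobordantChart.chart (fun _ : Fin N => 1) c) H = X 0 ^ n * B := by
  have hdvd : (X 0 : MvPowerSeries (Fin (N + 1)) k) ^ n ∣ subst (CobordantChart.chart (fun _ : Fin N => 1) c) H := by
    rw [X_pow_dvd_iff]
    intro E hE
    rw [← Finsupp.cons_tail E]
    exact CobordantChart.coeff_subst_chart_eq_zero_of_lt (fun _ => 1) c (fun i hi => absurd hi one_ne_zero) H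
      (lt_of_lt_of_le (by exact_mod_cast hE) hn) _
  obtain ⟨B, hB⟩ := hdvd
  exact ⟨B, hB⟩

/-- THE TRANSFORM OF A MONIC FORM under the point blow-up at the exceptional point `pt = (c', γ)`, given the
factorisations `A_j ∘ chart(c') = s^{d-j+1} B_j`:  `s^d · ((γ + Y)^d + s · Σ_j B_j♮ (γ + Y)^j)`. -/
theorem transform_monic {d : ℕ} (A : Fin d → MvPowerSeries (Fin m) k) (pt : Fin (m + 1) → k)
    (B : Fin d → MvPowerSeries (Fin (m + 1)) k)
    (hB : ∀ j, subst (CobordantChart.chart (fun _ : Fin m => 1) (fun i => pt (Fin.castSucc i))) (A j) =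
      X 0 ^ (d - (j : ℕ) + 1) * B j) :
    subst (cruxChart k (fun _ : Fin (m + 1) => 1) pt)
        (X (Fin.last m) ^ d + ∑ j : Fin d, rename (Fin.succAboveEmb (Fin.last m)) (A j) * X (Fin.last m) ^ (j : ℕ)) =
      X 0 ^ d * ((C (pt (Fin.last m)) + X (Fin.last (m + 1))) ^ d +
        X 0 * ∑ j : Fin d, rename (Fin.succAboveEmb (Fin.last (m + 1))) (B j) *
          (C (pt (Fin.last m)) + X (Fin.last (m + 1))) ^ (j : ℕ)) := by
  have hs := hasSubst_of_constantCoeff_zero (constantCoeff_cruxChart (k := k) (fun _ : Fin (m + 1) => 1) pt)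
  have hlast : subst (cruxChart k (fun _ : Fin (m + 1) => 1) pt) (X (Fin.last m) : MvPowerSeries (Fin (m + 1)) k) =
      X 0 * (C (pt (Fin.last m)) + X (Fin.last (m + 1))) := by
    rw [subst_X hs, MultiplicityLift.cruxChart_last one_eq_insertNth pt, pow_one, if_pos one_pos]
  have hc' : (fun i => pt ((Fin.last m).succAbove i)) = fun i => pt (Fin.castSucc i) := by
    funext i; rw [Fin.succAbove_last]
  have hren : ∀ j, subst (cruxChart k (fun _ : Fin (m + 1) => 1) pt) (rename (Fin.succAboveEmb (Fin.last m)) (A j)) =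
      rename (Fin.succAboveEmb (Fin.last (m + 1))) (X 0 ^ (d - (j : ℕ) + 1) * B j) := by
    intro j
    rw [MultiplicityLift.subst_cruxChart_rename one_eq_insertNth pt (A j), hc', cruxChart_one_eq_chart, hB j]
  have h0 : (Fin.succAboveEmb (Fin.last (m + 1))) (0 : Fin (m + 1)) = 0 := succAboveEmb_succ_zero (Fin.last m)
  rw [← coe_substAlgHom hs]
  simp only [map_add, map_pow, map_sum, map_mul, coe_substAlgHom, hlast, hren, rename_X, h0]
  rw [mul_add (X 0 ^ d), mul_pow, ← mul_assoc (X 0 ^ d) (X 0), Finset.mul_sum]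
  congr 1
  refine Finset.sum_congr rfl fun j _ => ?_
  have hj : (j : ℕ) < d := j.2
  have hd : (X 0 : MvPowerSeries (Fin (m + 1 + 1)) k) ^ d = X 0 ^ (j : ℕ) * X 0 ^ (d - (j : ℕ)) := by
    rw [← pow_add]; congr 1; omega
  have hd' : (X 0 : MvPowerSeries (Fin (m + 1 + 1)) k) ^ (d - (j : ℕ) + 1) = X 0 ^ (d - (j : ℕ)) * X 0 := pow_succ _ _
  rw [hd, hd', mul_pow]
  ring

/-- Coefficients of `s · R` at exponents without `s` vanish. -/
theorem coeff_X_zero_mul_of_zero {E : Fin (m + 1 + 1) →₀ ℕ} (hE : E 0 = 0) (R : MvPowerSeries (Fin (m + 1 + 1)) k) :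
    coeff E (X 0 * R) = 0 := by
  classical
  rw [X_def, coeff_monomial_mul, if_neg]
  intro h
  have h0 := h 0
  rw [Finsupp.single_eq_same, hE] at h0
  exact absurd h0 (by norm_num)

/-- The `Y^d`-coefficient of the saturated transform `g₀ = (γ + Y)^d + s · R` is `1`. -/
theorem coeff_top_g₀ (d : ℕ) (γ : k) (R : MvPowerSeries (Fin (m + 1 + 1)) k) :
    coeff (Finsupp.single (Fin.last (m + 1)) d) ((C γ + X (Fin.last (m + 1))) ^ d + X 0 * R) = 1 := by
  rw [map_add, coeff_X_zero_mul_of_zero (by rw [Finsupp.single_apply, if_neg Fin.last_pos.ne']) R, add_zero,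
    ← one_mul ((C γ + X (Fin.last (m + 1))) ^ d), ← map_one C, MultiplicityLift.coeff_single_C_mul_add_pow,
    Nat.choose_self, Nat.sub_self, pow_zero, Nat.cast_one, one_mul, one_mul]

/-- The constant coefficient of `g₀ = (γ + Y)^d + s · R` is `γ^d`. -/
theorem constantCoeff_g₀ (d : ℕ) (γ : k) (R : MvPowerSeries (Fin (m + 1 + 1)) k) :
    constantCoeff ((C γ + X (Fin.last (m + 1))) ^ d + X 0 * R) = γ ^ d := by
  rw [map_add, map_pow, map_add, constantCoeff_C, constantCoeff_X, add_zero, map_mul, constantCoeff_X, zero_mul,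
    add_zero]

/-! ### The slice of the saturated transform at `γ = 0` -/

/-- THE SLICE `x'_{i₀} ↦ 0` of `g₀ = Y^d + s · Σ_j B_j♮ Y^j` is the MONIC form `y^d + Σ_j (s B_j)|♮ y^j` one dimension
down. -/
theorem slice_g₀ {d : ℕ} (i₀ : Fin m) (B : Fin d → MvPowerSeries (Fin (m + 1)) k) :
    subst (fun j : Fin (m + 1 + 1) => if j = (Fin.castSucc i₀).succ then (0 : MvPowerSeries (Fin (m + 1)) k)
        else X (Fin.predAbove (Fin.castSucc i₀) j))
      ((C (0 : k) + X (Fin.last (m + 1))) ^ d +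
        X 0 * ∑ j : Fin d, rename (Fin.succAboveEmb (Fin.last (m + 1))) (B j) *
          (C (0 : k) + X (Fin.last (m + 1))) ^ (j : ℕ)) =
      X (Fin.last m) ^ d +
        ∑ j : Fin d, rename (Fin.succAboveEmb (Fin.last m)) (TupleGame.slice i₀ (X 0 * B j)) * X (Fin.last m) ^ (j : ℕ) := by
  cases m with
  | zero => exact i₀.elim0
  | succ m =>
    have hs := CobordantChartPlaneSlice.hasSubst_slice (R := k) (Fin.castSucc i₀)
    have h0 : (Fin.succAboveEmb (Fin.last (m + 1))) (0 : Fin (m + 1)) = 0 := succAboveEmb_succ_zero (Fin.last m)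
    rw [map_zero, zero_add, ← coe_substAlgHom hs]
    simp only [map_add, map_mul, map_pow, map_sum]
    simp only [coe_substAlgHom, MultiplicityLift.slice_X_zero, MultiplicityLift.slice_X_last,
      MultiplicityLift.slice_rename]
    rw [Finset.mul_sum]
    congr 1
    refine Finset.sum_congr rfl fun j _ => ?_
    rw [← pow_one (X 0 : MvPowerSeries (Fin (m + 1 + 1)) k), MultiplicityLift.slice_X_zero_pow_mul, map_mul, map_pow,
      rename_X, h0]
    ring


end MonicPointBlowup

open MonicPointBlowup MvPowerSeries in
/-- THE POINT BLOW-UP OF A MONIC FORM (every characteristic `p`, every dimension `m + 1`, every degree `d ≥ 1`).  Let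
`P = y^d + Σ_{j<d} A_j(x') y^j` with `y`-free `A_j` and `ord A_j > d - j` (Weierstrass form of a germ with unary tangent
cone, `WeierstrassForm.exists_monicForm`).  Blow up the origin (weights `(1, …, 1)`, no coordinate change).  Then:
* at an exceptional point with `γ = c_y ≠ 0` the saturated transform `(γ + Y)^d + s·(…)` is a unit — Refuter cannot go there;
* at `γ = 0`, `c' ≠ 0`, the saturated transform is `g₀ = Y^d + s · Σ_j B_j♮ Y^j` with `A_j ∘ chart(c') = s^{d-j+1} B_j`,
  and for every live slot `i₀` (`c'_{i₀} ≠ 0`, tame: weight `1`) it is a unit times a coordinate change of the cylinder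
  over its slice `S = y^d + Σ_j (s B_j)|_{x'_{i₀} = c'_{i₀} s} y^j`, again a MONIC form one blow-up later (`tameSlice`,
  `won_cyl`).
Hence `P` is won as soon as every such singular slice `S` is won.  (The slice need not satisfy `ord > d - j` any more:
deciding what happens there — order drop, hyperbolic quadric, re-preparation `y ↦ y + φ` — is the caller's strategy.) -/
theorem won_monic_of_pointBlowup (p : ℕ) (hp : p.Prime) (k : Type) [Field k] [CharP k p] (m d : ℕ) (hd : 0 < d)
    (A : Fin d → MvPowerSeries (Fin m) k) (hA : ∀ j : Fin d, ((d - (j : ℕ) : ℕ) : ℕ∞) < (A j).order)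
    (hsucc : ∀ (c : Fin m → k) (i₀ : Fin m), c i₀ ≠ 0 → ∀ B : Fin d → MvPowerSeries (Fin (m + 1)) k,
      (∀ j, MvPowerSeries.subst (CobordantChart.chart (fun _ : Fin m => 1) c) (A j) =
        MvPowerSeries.X 0 ^ (d - (j : ℕ) + 1) * B j) →
      CobordantGame.IsSingular k (MvPowerSeries.X (Fin.last m) ^ d +
        ∑ j : Fin d, MvPowerSeries.rename (Fin.succAboveEmb (Fin.last m))
          (TupleGame.slice i₀ (MvPowerSeries.X 0 * B j)) * MvPowerSeries.X (Fin.last m) ^ (j : ℕ)) →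
      CobordantGame.Won k (m + 1) (MvPowerSeries.X (Fin.last m) ^ d +
        ∑ j : Fin d, MvPowerSeries.rename (Fin.succAboveEmb (Fin.last m))
          (TupleGame.slice i₀ (MvPowerSeries.X 0 * B j)) * MvPowerSeries.X (Fin.last m) ^ (j : ℕ))) :
    CobordantGame.Won k (m + 1) (MvPowerSeries.X (Fin.last m) ^ d +
      ∑ j : Fin d, MvPowerSeries.rename (Fin.succAboveEmb (Fin.last m)) (A j) * MvPowerSeries.X (Fin.last m) ^ (j : ℕ)) := by
  classical
  set P : MvPowerSeries (Fin (m + 1)) k := X (Fin.last m) ^ d +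
    ∑ j : Fin d, rename (Fin.succAboveEmb (Fin.last m)) (A j) * X (Fin.last m) ^ (j : ℕ) with hP
  refine Won.move X (fun _ => 1) (TangentConeCut.isMove_X_one (Nat.succ_pos m)) fun g hg => ?_
  obtain ⟨pt, a, ⟨l, -, hptl⟩, hfac, hndvd, hsing⟩ := hg
  have hself : subst (X : Fin (m + 1) → MvPowerSeries (Fin (m + 1)) k) P = P := by
    rw [subst_self]; rfl
  rw [hself] at hfac
  -- the factorisations `A_j ∘ chart(c') = s^{d-j+1} B_j`
  set c : Fin m → k := fun i => pt (Fin.castSucc i) with hc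
  have hBex : ∀ j : Fin d, ∃ Bj : MvPowerSeries (Fin (m + 1)) k,
      subst (CobordantChart.chart (fun _ : Fin m => 1) c) (A j) = X 0 ^ (d - (j : ℕ) + 1) * Bj := fun j =>
    exists_eq_X_pow_mul_of_le_order c (A j) _ (Order.add_one_le_of_lt (hA j))
  choose B hB using hBex
  -- the transform and the saturated successor `g₀`
  set γ : k := pt (Fin.last m) with hγ
  set g₀ : MvPowerSeries (Fin (m + 1 + 1)) k := (C γ + X (Fin.last (m + 1))) ^ d +
    X 0 * ∑ j : Fin d, rename (Fin.succAboveEmb (Fin.last (m + 1))) (B j) * (C γ + X (Fin.last (m + 1))) ^ (j : ℕ)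
    with hg₀
  have hT : subst (cruxChart k (fun _ : Fin (m + 1) => 1) pt) P = X 0 ^ d * g₀ := by
    rw [hP, transform_monic A pt B hB]
  have hndvd₀ : ¬ X 0 ∣ g₀ := fun h => by
    have h1 := coeff_top_g₀ (m := m) d γ
      (∑ j : Fin d, rename (Fin.succAboveEmb (Fin.last (m + 1))) (B j) * (C γ + X (Fin.last (m + 1))) ^ (j : ℕ))
    rw [X_dvd_iff.mp h _ (by rw [Finsupp.single_apply, if_neg Fin.last_pos.ne'])] at h1
    exact zero_ne_one h1
  have hfac₀ := hfac
  rw [hT] at hfac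
  obtain ⟨-, hgg⟩ := X_pow_mul_eq_X_pow_mul 0 hfac hndvd₀ hndvd
  subst hgg
  -- `γ = 0`: otherwise `g₀(0) = γ^d ≠ 0`
  have hγ0 : γ = 0 := by
    have h00 := hsing.1
    rw [hg₀, constantCoeff_g₀] at h00
    exact pow_eq_zero_iff (n := d) (by omega) |>.mp h00
  -- a live old slot `i₀` (the exceptional point is off the vertex and `γ = 0`)
  obtain ⟨i₀, rfl⟩ : ∃ i₀ : Fin m, Fin.castSucc i₀ = l := by
    rcases Fin.eq_castSucc_or_eq_last l with ⟨i₀, rfl⟩ | rfl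
    · exact ⟨i₀, rfl⟩
    · exact absurd hγ0 hptl
  have hci₀ : c i₀ ≠ 0 := hptl
  -- the tame slice at `i₀`
  rw [cruxChart_one_eq_chart] at hfac₀
  obtain ⟨Φ₂, u, hΦ₂0, hΦ₂det, hu, hgeq⟩ := tameSlice p hp k (m + 1) P (fun _ => 1) pt
    (fun i hi => absurd hi one_ne_zero) a g₀ hfac₀ (Fin.castSucc i₀) hci₀ (by exact hp.not_dvd_one)
  set S : MvPowerSeries (Fin (m + 1)) k := subst (fun j : Fin (m + 1 + 1) => if j = (Fin.castSucc i₀).succ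
    then (0 : MvPowerSeries (Fin (m + 1)) k) else X (Fin.predAbove (Fin.castSucc i₀) j)) g₀ with hS
  suffices hWS : Won k (m + 1) S by
    rw [hgeq]
    exact (won_unit_mul_iff hu _).mpr ((won_subst_iff hΦ₂0 hΦ₂det _).mpr (won_cyl (Fin.castSucc i₀).succ hWS))
  -- the slice is the monic form `y^d + Σ_j (s B_j)| y^j`
  have hSeq : S = X (Fin.last m) ^ d +
      ∑ j : Fin d, rename (Fin.succAboveEmb (Fin.last m)) (TupleGame.slice i₀ (X 0 * B j)) * X (Fin.last m) ^ (j : ℕ) := by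
    rw [hS, hg₀, hγ0]
    exact slice_g₀ i₀ B
  by_cases hSs : IsSingular k S
  · rw [hSeq] at hSs ⊢
    exact hsucc c i₀ hci₀ B hB hSs
  · exact (wonBy_zero_of_not_isSingular m.succ_pos hSs).won


end Summit.ResolutionOfSingularities.ResolutionOfSingularities.Theorems
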